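import Summits.BirchSwinnertonDyer.BirchSwinnertonDyer.Theorems.ErratumRoadFiveShimuraKolyvaginOrderBoundInertMachineEntry
import Summits.BirchSwinnertonDyer.Rank1Residual.X11b.KolyvaginH44Localized
import HarnessLib

/-!
# Route `ErratumRoadFive`, crux `ShimuraKolyvaginOrderBoundInertFromFive` (item
# stmt-BirchSwinnertonDyer-19718) — the KEY RELATION (McCallum 1991 Prop. 4.4 at `λ ∣ m`, clause (f)
# of the machine's `hpoints`) for ABSTRACT ring-class Euler-system data, keyed on the conductor

Cell `bsd-stepL`, seat `bsd-stepL-shim-p1` (prover g7), HELPER for the crux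
`Summit.BirchSwinnertonDyer.BirchSwinnertonDyer.Theses.ErratumRoadFive.ShimuraKolyvaginOrderBoundInertFromFive`
(`--supports stmt-BirchSwinnertonDyer-19718 --as helper`; K2 route `route-BirchSwinnertonDyer-ErratumRoadFive`
rev 19; skeleton v2 df9d5864b1b31f6b, stub S1 `stub_inert_unitIndex`). Fourth file of the session: the
first brick of the CARRIER side (memo HOME/shim/LOCAL-HALF-19718.md §2 (α)) after `…InertLocalAll`
(p469959), `…InertMachineEntry` (p470900), `…InertReciprocity` (p471634).

## What this file proves

The END `sha_primary_eq_zero_of_ringClassRationalPointsM` (p470900 §4) reduces S1 to a ring-class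
Euler-system datum `hpointsR` with five clauses; clause (f) — McCallum 1991 Prop. 4.4 at `λ ∣ m`, the
key relation between `c_M(m)` and `c_M(m/ℓ)` at the unique place `λ` of `K` above the Kolyvagin prime
`ℓ` — is the deepest (localized Galois cohomology at `λ`: reduction datum, Frobenius eigenlines,
Euler-system root). x11b3 proved it for ABSTRACT data (group `𝒢 m` acting on `A₀ m`, generators `σ m ℓ`,
points `y m`, equivariant embeddings `j m : A₀ m → E(K̄)`, Galois dictionary of the ring class fields
`K[m]`) from the LABEL `h37` (Gross 1991 Prop. 3.7 (1)+(2): trace relation and congruence) in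
`X11b/KolyvaginH44LocalizedCore.lean` ∕ `…Localized.lean` — but keyed on `hHP : IsHeegnerPoint N W K P`,
used three times, each for good reduction at the Kolyvagin prime. THIS FILE re-keys both theorems on
`hN : W.conductorNorm ℤ = N` (proofs copied token for token, the three uses served by
`hasGoodReductionAt_place_of_isKolyvaginPrime_of_conductorNorm` (p470900), `WeierstrassCurve.dvd_conductorNorm_iff`
and the machine's `pow_dvd_frobeniusTraceAt_of_frobEqFrobInfty`):

* §1 `h44_of_prop37_of_ringClassDecomposition_on_of_conductorNorm` — clause (f) at the levels `R` from
  `h37`, `hsplit`, `hram` (all three labelled);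
* §2 **`h44_of_prop37_on_of_conductorNorm`** — clause (f) at the levels `R` from `h37` ALONE plus the
  Galois dictionary (`e m : K[m] →ₐ[K] K̄`, `ρ m`, `hπρ`, `hσρ`), `hsplit` ∕ `hram` discharged by x11b3's
  ring-class theorems (`hsplit_of_ringClassField`, `hram_of_totallyRamified_on`, `htot_of_classFieldTheory`,
  `hrat_of_galoisDictionary`) — usable VERBATIM for the CM points of `X_{N⁺,N⁻}` once their trace relation
  (Bertolini–Darmon 1996 §2.4, Nekovář 2007 (4.8)) and congruence (Nekovář 2007 (4.9)) are typed as `h37`.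

## Honest framing

THEOREMS ONLY (no `def`, no named fact, no `sorry`; axioms standard). Nothing X₀(N)- or
X_{N⁺,N⁻}-specific is used or discharged: `h37` stays a labelled hypothesis. Item 19718 and S1 ∕ S2 stay
OPEN (K2's imported open input, `tribunal_fit.residual`); what remains for S1 is memo §2: the carrier's
other clauses (existence ∕ rationality of the CM points, Gross 5.4 (1) eigen relation — x11b3's
`KolyvaginTauEigenConcrete` to be re-seamed the same way —, `P_m ∈ invPoints`, admissibility — x11b3's
structure-free `torsionBy_pow_ringClassField_eq_bot`) + `hTam` + `0 < index`. BSD is not proved by any of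
this; no census number moves.

References: [cite: McCallumLMS1991, Prop. 4.4, Lemma 4.3, §4 (p. 282 l. 1)] [cite: GrossLMS1991, Prop. 3.7,
§3 (3.1)–(3.4), p. 217 l. 1–3, p. 218 l. 1, Prop. 6.2 (2)] [cite: Cox2013, §9.A]
[cite: BertoliniDarmon1996, §2.4, Prop. 2.6] [cite: Kim2022HigherGZ, §2.1 and Thm. 4.3].
Cell files: HOME/shim/LOCAL-HALF-19718.md (8a9e9098479dadb7) §2–§3. presearch: as `…InertMachineEntry`
(S1S2-ROAD §4 ∕ SHIM-T1 §7.5, corpus + galaxy): the key relation for Shimura-curve Heegner points is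
derived in print only by reference to Gross ∕ McCallum (BD96 §2, Kim 2024 §4); `lean search
'h44_of_prop37.*conductorNorm'` → no matches.
-/

noncomputable section

open scoped Classical Pointwise

set_option linter.dupNamespace false

namespace Summit.BirchSwinnertonDyer.BirchSwinnertonDyer.Theorems

open WeierstrassCurve Field NumberField IsDedekindDomain Finset
  Literature.NumberTheory.EllipticCurves Literature.NumberTheory.GaloisRepresentations
  Literature.NumberTheory.EllipticCurves.KolyvaginCocycle
  Literature.NumberTheory.EllipticCurves.KolyvaginEuler
  Literature.NumberTheory.EllipticCurves.RingClassField
  Rat.HeightOneSpectrum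
  Summit.BirchSwinnertonDyer.Rank1Residual.X11b
  Summit.BirchSwinnertonDyer.Rank1Residual.X11b.KolyvaginH44

variable {K : Type} [Field K] [NumberField K]

/-! ### §1 McCallum's Prop. 4.4 from Gross's Prop. 3.7 at the levels `R`, keyed on the conductor -/

/-- **McCallum 1991, Prop. 4.4 at `λ ∣ m` (clause (f) of the machine's `hpoints`: the key relation
between `c_M(m)` and `c_M(m/ℓ)` at `λ`) from Gross's Prop. 3.7 and the ring-class decomposition at `λ`,
for ABSTRACT Euler-system data, at the levels `m` with `R m` — conductor-keyed twin of x11b3's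
`KolyvaginH44.h44_of_prop37_of_ringClassDecomposition_on` (`X11b/KolyvaginH44LocalizedCore.lean`).**
Data (x11b3's abstract telescope, structure-free): groups `𝒢 m` acting on modules `A₀ m` ("`Gal(K[m]/K)`
on `E(K[m])`"), generators `σ m ℓ` of order `ℓ + 1`, coset sections `f m`, points `y m`, Galois maps
`π m : Γ_K → 𝒢 m`, equivariant embeddings `j m : A₀ m → E(K̄)` with admissible image, the derived
points `kolyvaginPoint (σ m) (L m) (f m) (y m)` in `invPoints` and fixed by local inertia off `m`; the
LABELLED inputs `h37` (Gross 1991 Prop. 3.7 (1) trace relation + (2) congruence, with the inter-level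
lift — for `X_{N⁺,N⁻}`: Bertolini–Darmon 1996 §2.4 and Nekovář 2007 (4.8)–(4.9)), `hsplit` (`λ` splits
completely in `K[m/ℓ]`) and `hram` (total ramification of `λ_m` in `K[m]`, `G_ℓ = ⟨σ_ℓ⟩`). Proof: x11b3's,
token for token (adapted from `X11b/KolyvaginH44LocalizedCore.lean`), EXCEPT that its three uses of
`hHP : IsHeegnerPoint N W K P` — good reduction at `λ`, at the place `(ℓ)` of `ℚ`, and `p^M ∣ a_ℓ` via
`IsKolyvaginPrime.pow_dvd_frobeniusTraceAt` — are served from `hN : W.conductorNorm ℤ = N`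
(`hasGoodReductionAt_place_of_isKolyvaginPrime_of_conductorNorm`, `WeierstrassCurve.dvd_conductorNorm_iff`,
the machine's `pow_dvd_frobeniusTraceAt_of_frobEqFrobInfty`). HONEST: `h37` ∕ `hsplit` ∕ `hram` are
hypotheses, not discharged; nothing X₀(N)- or X_{N⁺,N⁻}-specific is used.
[cite: McCallumLMS1991, Prop. 4.4, Lemma 4.3, §4 (p. 282 l. 1)] [cite: GrossLMS1991, Prop. 3.7,
Prop. 6.2 (2), §3 (3.1)–(3.4)] [cite: BertoliniDarmon1996, §2.4] -/
theorem h44_of_prop37_of_ringClassDecomposition_on_of_conductorNorm {N : ℕ} [NeZero N]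
    {W : WeierstrassCurve ℚ} [W.IsElliptic] [W.IsGloballyMinimal] (hK : IsImaginaryQuadratic K)
    (hN : W.conductorNorm ℤ = N)
    {p M : ℕ} (hp : p.Prime) (hp2 : p ≠ 2) (hM : 1 ≤ M) (hW : W.exists_weilPairing p)
    (hdiv : ∀ Q : geomPoints (W.baseChange K), ∃ R, ((p ^ M : ℕ) : ℤ) • R = Q)
    {𝒢 : ℕ → Type*} [∀ m, CommGroup (𝒢 m)] {A₀ : ℕ → Type*} [∀ m, AddCommGroup (A₀ m)]
    [∀ m, DistribMulAction (𝒢 m) (A₀ m)]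
    (σ : ∀ m, ℕ → 𝒢 m) (L : ℕ → Finset ℕ) (H : ∀ m, Subgroup (𝒢 m))
    [∀ m, Fintype (𝒢 m ⧸ H m)] (f : ∀ m, 𝒢 m ⧸ H m → 𝒢 m)
    (hord : ∀ m, ∀ ℓ ∈ L m, σ m ℓ ^ (ℓ + 1) = 1)
    (y : ∀ m, A₀ m)
    (π : ∀ m, absoluteGaloisGroup K →* 𝒢 m) (j : ∀ m, A₀ m →+ geomPoints (W.baseChange K))
    (hj : ∀ m (g : absoluteGaloisGroup K) (a : A₀ m), j m (π m g • a) = g • j m a)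
    (hA : ∀ m, IsAdmissible (absoluteGaloisGroup K) (j m).range ((p ^ M : ℕ) : ℤ))
    (hPt : ∀ m, j m (kolyvaginPoint (σ m) (L m) (f m) (y m)) ∈
      invPoints (absoluteGaloisGroup K) (j m).range ((p ^ M : ℕ) : ℤ))
    (hI : ∀ m : ℕ, ∀ v : HeightOneSpectrum (𝓞 K), (m : 𝓞 K) ∉ v.asIdeal →
      ∀ 𝔐 ∈ v.localPrimesAbove, ∀ t ∈ 𝔐.inertia (absoluteGaloisGroup (v.adicCompletion K)),
        resGal (K := K) (v.adicCompletion K) t • j m (kolyvaginPoint (σ m) (L m) (f m) (y m)) =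
          j m (kolyvaginPoint (σ m) (L m) (f m) (y m)))
    (R : ℕ → Prop)
    (h37 : ∀ m : ℕ, R m → Squarefree m →
      (∀ q ∈ m.primeFactors, IsKolyvaginPrime N W K p q ∧ FrobEqFrobInfty W K (p ^ M) q) →
      ∀ ℓ : ℕ, ℓ.Prime → ℓ ∣ m →
      ℓ ∈ L m ∧ ∃ y' : A₀ m,
        j m (kolyvaginPoint (σ m) ((L m).erase ℓ) (f m) y') =
          j (m / ℓ) (kolyvaginPoint (σ (m / ℓ)) (L (m / ℓ)) (f (m / ℓ)) (y (m / ℓ))) ∧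
        grAct (A₀ m) (traceElt (σ m ℓ) ℓ) (y m) = W.frobeniusTrace ℓ • y' ∧
        ∀ [Fact ℓ.Prime] (hΔ : ¬ (ℓ : ℤ) ∣ minimalDiscriminantInt W)
          (φ₀ : absoluteGaloisGroup (ZMod ℓ)), (∀ x : AlgebraicClosure (ZMod ℓ), φ₀ • x = x ^ ℓ) →
          ∀ γ : 𝒢 m, geomReduction hΔ ((RatClosure.pointsEquiv (K := K) W).symm (j m (γ • y m))) =
            φ₀ • geomReduction hΔ ((RatClosure.pointsEquiv (K := K) W).symm (j m (γ • y'))))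
    (hsplit : ∀ m : ℕ, R m → Squarefree m →
      (∀ q ∈ m.primeFactors, IsKolyvaginPrime N W K p q ∧ FrobEqFrobInfty W K (p ^ M) q) →
      ∀ ℓ : ℕ, ℓ.Prime → ℓ ∣ m → ∀ v : HeightOneSpectrum (𝓞 K), (ℓ : 𝓞 K) ∈ v.asIdeal →
      ∀ 𝔓 ∈ v.primesAbove, ∀ F : absoluteGaloisGroup K, IsArithFrobAt (𝓞 K) F 𝔓 →
        F • j (m / ℓ) (kolyvaginPoint (σ (m / ℓ)) (L (m / ℓ)) (f (m / ℓ)) (y (m / ℓ))) =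
          j (m / ℓ) (kolyvaginPoint (σ (m / ℓ)) (L (m / ℓ)) (f (m / ℓ)) (y (m / ℓ))))
    (hram : ∀ m : ℕ, R m → Squarefree m →
      (∀ q ∈ m.primeFactors, IsKolyvaginPrime N W K p q ∧ FrobEqFrobInfty W K (p ^ M) q) →
      ∀ ℓ : ℕ, ℓ.Prime → ℓ ∣ m → ∀ v : HeightOneSpectrum (𝓞 K), (ℓ : 𝓞 K) ∈ v.asIdeal →
      ∀ 𝔓 ∈ v.primesAbove, ∃ τ₀ ∈ 𝔓.inertia (absoluteGaloisGroup K), π m τ₀ = σ m ℓ ∧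
        ∀ τ ∈ 𝔓.inertia (absoluteGaloisGroup K), ∃ i : ℕ, ∀ x ∈ (j m).range,
          τ • x = (τ₀ ^ i) • x) :
    ∀ m : ℕ, R m → Squarefree m →
      (∀ q ∈ m.primeFactors, IsKolyvaginPrime N W K p q ∧ FrobEqFrobInfty W K (p ^ M) q) →
      ∀ ℓ : ℕ, ℓ.Prime → ℓ ∣ m → ∀ v : HeightOneSpectrum (𝓞 K), (ℓ : 𝓞 K) ∈ v.asIdeal →
        ∀ a : ℕ, (((p : ℤ) ^ a) • kolyvaginClass (W.baseChange K) _ hdiv (hA m)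
              (j m (kolyvaginPoint (σ m) (L m) (f m) (y m))) (hPt m) ∈
            selmerLocalKer (W.baseChange K) (v.adicCompletion K) ((p ^ M : ℕ) : ℤ) ↔
          ((p : ℤ) ^ a) • kolyvaginClass (W.baseChange K) _ hdiv (hA (m / ℓ))
              (j (m / ℓ) (kolyvaginPoint (σ (m / ℓ)) (L (m / ℓ)) (f (m / ℓ)) (y (m / ℓ))))
              (hPt (m / ℓ)) ∈
            (W.baseChange K).torsionLocalKer (v.adicCompletion K) ((p ^ M : ℕ) : ℤ)) := by
  intro m hRm hm hkol ℓ hℓp hℓm v hv a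
  have hm0 : m ≠ 0 := Squarefree.ne_zero hm
  have hℓmem : ℓ ∈ m.primeFactors := Nat.mem_primeFactors.mpr ⟨hℓp, hℓm, hm0⟩
  obtain ⟨hℓ, hℓM⟩ := hkol ℓ hℓmem
  haveI : Fact ℓ.Prime := ⟨hℓp⟩
  haveI : Fact p.Prime := ⟨hp⟩
  have hvpl : v = hℓ.place := hℓ.mem_iff.mp hv
  have hpℓ : p ≠ ℓ := fun h ↦ hℓ.2.2.2.1 h.symm
  have hℓpM : ¬ ℓ ∣ p ^ M := fun h ↦
    hpℓ ((Nat.prime_dvd_prime_iff_eq hℓp hp).mp (hℓp.dvd_of_dvd_pow h)).symm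
  have hpM0 : p ^ M ≠ 0 := pow_ne_zero M hp.ne_zero
  -- good reduction at `λ` and at the place `v₀ = (ℓ)` of `ℚ`; `ℓ ∤ Δ_W`
  have hgood : (W.baseChange K).HasGoodReductionAt v := by
    rw [hvpl]
    exact Theorems.hasGoodReductionAt_place_of_isKolyvaginPrime_of_conductorNorm W hN hℓ
  obtain ⟨v₀, hv₀, hℓv₀⟩ := exists_ratPlace ℓ
  have hgood₀ : W.HasGoodReductionAt v₀ := by
    by_contra hbad
    have hdvd := (W.dvd_conductorNorm_iff v₀).mpr hbad
    rw [hv₀, hN] at hdvd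
    exact hℓ.2.1 hdvd
  have hΔ : ¬ (ℓ : ℤ) ∣ minimalDiscriminantInt W := by
    have h1 := (hasGoodReductionAtPrime_iff_hasGoodReductionAt_ringOfIntegers v₀ W).mpr hgood₀
    have h2 := @not_dvd_minimalDiscriminantInt_of_hasGoodReductionAtPrime' W _
      (primesEquiv v₀ : ℕ) (Fact.mk (primesEquiv v₀).2) h1
    rwa [hv₀] at h2
  -- `p^M ∣ ℓ + 1`, `p^M ∣ a_ℓ`
  obtain ⟨-, l', hl'⟩ := IsKolyvaginPrime.pow_dvd_add_one W hp hℓ hM hℓM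
  have haℓ : ((p : ℤ) ^ M) ∣ W.frobeniusTrace ℓ := by
    have h := pow_dvd_frobeniusTraceAt_of_frobEqFrobInfty W (K := K) hp hM hℓ.prime hℓ.2.2.2.1 hℓM
      hℓv₀ hgood₀
    rw [frobeniusTraceAt_eq_frobeniusTrace W v₀] at h
    rwa [show ((primesEquiv v₀ : ℕ)) = ℓ from hv₀] at h
  obtain ⟨a', ha'⟩ := haℓ
  have hpl : p ∣ ℓ + 1 := by
    have : (p : ℤ) ∣ ((ℓ + 1 : ℕ) : ℤ) := by
      rw [hl']; exact Dvd.dvd.mul_right (dvd_pow_self (p : ℤ) (by omega)) l'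
    exact_mod_cast this
  have hpa : (p : ℤ) ∣ W.frobeniusTrace ℓ := by
    rw [ha']; exact Dvd.dvd.mul_right (dvd_pow_self (p : ℤ) (by omega)) a'
  -- the inert place: uniqueness and `q_λ = ℓ²`
  have huniq : ∀ w : HeightOneSpectrum (𝓞 K), (ℓ : 𝓞 K) ∈ w.asIdeal → w = v :=
    fun w hw ↦ (hℓ.mem_iff.mp hw).trans hvpl.symm
  have hres : v.residueCard = ℓ ^ 2 := by rw [hvpl]; exact residueCard_place_eq_sq hK hℓ
  -- the Frobenius of `𝔽̄_ℓ`
  obtain ⟨φ₀, hφ₀'⟩ := exists_frobenius_absoluteGaloisGroup (ZMod ℓ)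
  have hφ₀ : ∀ x : AlgebraicClosure (ZMod ℓ), φ₀ • x = x ^ ℓ := fun x ↦ by
    rw [hφ₀' x, Nat.card_zmod]
  -- Prop. 3.7 at `(m, ℓ)` and the inter-level lift
  obtain ⟨hℓL, y', hy'P, hrel, hES⟩ := h37 m hRm hm hkol ℓ hℓp hℓm
  -- the Selmer condition of `c_M(m/ℓ)` at the good place `λ ∤ m/ℓ` (McCallum Lemma 4.3)
  have hmv : ((m / ℓ : ℕ) : 𝓞 K) ∉ v.asIdeal := by
    intro h
    rw [hvpl] at h
    have hdvd := dvd_of_natCast_mem_place hℓ hv₀ hℓv₀ h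
    have : ℓ * ℓ ∣ m := by
      have := Nat.mul_dvd_mul_left ℓ hdvd
      rwa [Nat.mul_div_cancel' hℓm] at this
    exact hℓp.one_lt.ne' (Nat.isUnit_iff.mp (hm ℓ this))
  obtain ⟨𝔐, h𝔐⟩ := v.localPrimesAbove_nonempty
  have hsel₂ := Three.GrossBadPlace.kolyvaginClass_mem_selmerLocalKer_of_inertia_of_hasGoodReductionAt
    (W.baseChange K)
    (hdiv := hdiv) (hA (m / ℓ)) (hPt (m / ℓ)) v hgood h𝔐 (hI (m / ℓ) v hmv 𝔐 h𝔐)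
  -- McCallum Prop. 4.4 in order form, from the reduction datum
  refine zsmul_kolyvaginClass_mem_selmerLocalKer_iff_of_isKolyvaginPrime W hK hp hp2 hℓ hℓM hv
    hgood (hA m) (hA (m / ℓ)) (hPt m) (hPt (m / ℓ)) hsel₂ (a := W.frobeniusTrace ℓ) hl' ha' ?_ _
  intro 𝔓 h𝔓 F hF hFfix
  refine ⟨hsplit m hRm hm hkol ℓ hℓp hℓm v hv 𝔓 h𝔓 F hF, ?_⟩
  obtain ⟨g, red, φ, hredg, hφ, hredI, hredF, hred, hBn, htors, hchar, hcyc⟩ :=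
    exists_reductionDatum W hΔ hp2 hpℓ hW hpl hpa hℓ.2.2.2.2.2 hφ₀ hv huniq hres h𝔓 hℓpM hpM0 hF
      hFfix
  obtain ⟨τ₀, hτ₀I, hπτ₀, hIτ₀⟩ := hram m hRm hm hkol ℓ hℓp hℓm v hv 𝔓 h𝔓
  -- Prop. 3.7 (2) for the reduction along `𝔓`
  have hES' : ∀ γ : 𝒢 m, red (j m (γ • y m)) = φ (red (j m (γ • y'))) := by
    intro γ
    rw [hredg, hredg, hφ, ← hj, ← hj, ← mul_smul, ← mul_smul]
    exact hES hΔ φ₀ hφ₀ _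
  -- the Euler-system root at `λ`
  have hlZ : ((ℓ + 1 : ℕ) : ℤ) = ((p ^ M : ℕ) : ℤ) * l' := by rw [hl']; push_cast; ring
  have haZ : W.frobeniusTrace ℓ = ((p ^ M : ℕ) : ℤ) * a' := by rw [ha']; push_cast; ring
  obtain ⟨R₀, hR₀A, hR₀, hR₀red⟩ := exists_root_of_relation (π m) (j m) (hj m) hℓL
    (hord m ℓ hℓL) (f m) hrel hlZ haZ hπτ₀ red φ hES'
  rw [hy'P] at hR₀red
  -- lift `B = Ẽ(𝔽̄_ℓ)` to the universe of `K`
  set e : ULift.{0} (reductionModPrime W ℓ).geomPoints ≃+ (reductionModPrime W ℓ).geomPoints :=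
    AddEquiv.ulift with he
  set redL : geomPoints (W.baseChange K) →+ ULift.{0} (reductionModPrime W ℓ).geomPoints :=
    e.symm.toAddMonoidHom.comp red with hredLdef
  set φL : ULift.{0} (reductionModPrime W ℓ).geomPoints →+
      ULift.{0} (reductionModPrime W ℓ).geomPoints :=
    e.symm.toAddMonoidHom.comp (φ.comp e.toAddMonoidHom) with hφLdef
  have hredL : ∀ x, redL x = e.symm (red x) := fun _ ↦ rfl
  have hφL : ∀ b, φL b = e.symm (φ (e b)) := fun _ ↦ rfl
  refine ⟨ULift.{0} (reductionModPrime W ℓ).geomPoints, inferInstance, redL, φL, τ₀, R₀, ?_, ?_, ?_,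
    ?_, ?_, ?_, ?_, hτ₀I, hIτ₀, hR₀A, hR₀, ?_⟩
  · intro τ hτ x
    rw [hredL, hredL, hredI τ hτ x]
  · intro x
    rw [hredL, hφL, hφL, hredL, AddEquiv.apply_symm_apply, AddEquiv.apply_symm_apply, hredF x]
  · intro x hx h0
    rw [hredL, AddEquiv.map_eq_zero_iff] at h0
    exact hred x hx h0
  · intro b hb
    have hb' : (((p ^ M : ℕ) : ℤ)) • e b = 0 := by rw [← map_zsmul, hb, map_zero]
    rw [hφL, hφL, AddEquiv.apply_symm_apply, hBn _ hb', AddEquiv.symm_apply_apply]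
  · intro b hb
    have hb' : φ (φ (e b)) = e b := by
      have := congrArg e hb
      rwa [hφL, hφL, AddEquiv.apply_symm_apply, AddEquiv.apply_symm_apply] at this
    have h := e.symm.toAddMonoidHom.isOfFinAddOrder (htors _ hb')
    rwa [AddEquiv.coe_toAddMonoidHom, AddEquiv.symm_apply_apply] at h
  · intro b hb
    have hb' : φ (φ (e b)) = e b := by
      have := congrArg e hb
      rwa [hφL, hφL, AddEquiv.apply_symm_apply, AddEquiv.apply_symm_apply] at this
    apply e.injective
    rw [map_zsmul, map_zsmul, hφL, AddEquiv.apply_symm_apply]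
    exact hchar _ hb'
  · intro s hs
    obtain ⟨g₁, e₁, hg₁, hord₁, hdvd₁, hndvd₁, hgen₁⟩ := hcyc s hs
    refine ⟨e.symm g₁, e₁, ?_, ?_, hdvd₁, hndvd₁, fun c hc hck ↦ ?_⟩
    · rw [hφL, AddEquiv.apply_symm_apply, hg₁, map_zsmul]
    · rw [← hord₁]
      exact addOrderOf_injective e.symm.toAddMonoidHom e.symm.injective g₁
    · have hc' : φ (e c) = s • e c := by
        have := congrArg e hc
        rwa [hφL, AddEquiv.apply_symm_apply, map_zsmul] at this
      obtain ⟨k, hk⟩ := hck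
      obtain ⟨i, hi⟩ := hgen₁ (e c) hc' ⟨k, by rw [← map_zsmul, hk, map_zero]⟩
      refine ⟨i, e.injective ?_⟩
      rw [hi, map_zsmul, AddEquiv.apply_symm_apply]
  · rw [hredL, hredL, hφL, AddEquiv.apply_symm_apply, hR₀red, map_sub, map_zsmul, map_zsmul]

/-! ### §2 The same with the Galois dictionary of the ring class fields -/

/-- **McCallum's Prop. 4.4 at the levels `R` from Gross's Prop. 3.7 and the Galois dictionary —
conductor-keyed twin of x11b3's `KolyvaginH44.h44_of_prop37_on` (`X11b/KolyvaginH44Localized.lean`).**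
As §1, with `hsplit` ∕ `hram` DISCHARGED by x11b3's ring-class theorems (`hsplit_of_ringClassField` —
`λ = (ℓ)` splits completely in `K[m/ℓ]`; `hram_of_totallyRamified_on` + `htot_of_classFieldTheory` — the
primes of `K[m/ℓ]` above `ℓ` ramify totally in `K[m]`; `hrat_of_galoisDictionary`) from the dictionary
`e m : K[m] →ₐ[K] K̄`, `ρ m : 𝒢 m ↪ Aut(K[m])`, `hπρ` (compatibility of `π m` with `e m`), `hσρ`
(`ρ_m ⟨σ_m ℓ⟩ = Gal(K[m]/K[m/ℓ])`). The only remaining labelled input is `h37`. For the Shimura line this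
is clause (f) of `hpointsR` (`…MachineEntry` §4) for ANY ring-class Euler-system datum typed in x11b3's
abstract telescope. [cite: McCallumLMS1991, Prop. 4.4] [cite: GrossLMS1991, Prop. 3.7, §3 p. 217 l. 1–3,
p. 218 l. 1] [cite: Cox2013, §9.A] -/
theorem h44_of_prop37_on_of_conductorNorm {N : ℕ} {W : WeierstrassCurve ℚ} [NeZero N] [W.IsElliptic]
    [W.IsGloballyMinimal] (hK : IsImaginaryQuadratic K) (ι : K →+* ℂ) (hN : W.conductorNorm ℤ = N)
    {p M : ℕ} (hp : p.Prime) (hp2 : p ≠ 2) (hM : 1 ≤ M) (hW : W.exists_weilPairing p)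
    (hdiv : ∀ Q : geomPoints (W.baseChange K), ∃ R, ((p ^ M : ℕ) : ℤ) • R = Q)
    {𝒢 : ℕ → Type*} [∀ m, CommGroup (𝒢 m)] {A₀ : ℕ → Type*} [∀ m, AddCommGroup (A₀ m)]
    [∀ m, DistribMulAction (𝒢 m) (A₀ m)]
    (σ : ∀ m, ℕ → 𝒢 m) (L : ℕ → Finset ℕ) (H : ∀ m, Subgroup (𝒢 m))
    [∀ m, Fintype (𝒢 m ⧸ H m)] (f : ∀ m, 𝒢 m ⧸ H m → 𝒢 m)
    (hord : ∀ m, ∀ ℓ ∈ L m, σ m ℓ ^ (ℓ + 1) = 1)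
    (y : ∀ m, A₀ m)
    (π : ∀ m, absoluteGaloisGroup K →* 𝒢 m) (j : ∀ m, A₀ m →+ geomPoints (W.baseChange K))
    (hj : ∀ m (g : absoluteGaloisGroup K) (a : A₀ m), j m (π m g • a) = g • j m a)
    (hA : ∀ m, IsAdmissible (absoluteGaloisGroup K) (j m).range ((p ^ M : ℕ) : ℤ))
    (hPt : ∀ m, j m (kolyvaginPoint (σ m) (L m) (f m) (y m)) ∈
      invPoints (absoluteGaloisGroup K) (j m).range ((p ^ M : ℕ) : ℤ))
    (hI : ∀ m : ℕ, ∀ v : HeightOneSpectrum (𝓞 K), (m : 𝓞 K) ∉ v.asIdeal →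
      ∀ 𝔐 ∈ v.localPrimesAbove, ∀ t ∈ 𝔐.inertia (absoluteGaloisGroup (v.adicCompletion K)),
        resGal (K := K) (v.adicCompletion K) t • j m (kolyvaginPoint (σ m) (L m) (f m) (y m)) =
          j m (kolyvaginPoint (σ m) (L m) (f m) (y m)))
    (R : ℕ → Prop)
    (h37 : ∀ m : ℕ, R m → Squarefree m →
      (∀ q ∈ m.primeFactors, IsKolyvaginPrime N W K p q ∧ FrobEqFrobInfty W K (p ^ M) q) →
      ∀ ℓ : ℕ, ℓ.Prime → ℓ ∣ m →
      ℓ ∈ L m ∧ ∃ y' : A₀ m,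
        j m (kolyvaginPoint (σ m) ((L m).erase ℓ) (f m) y') =
          j (m / ℓ) (kolyvaginPoint (σ (m / ℓ)) (L (m / ℓ)) (f (m / ℓ)) (y (m / ℓ))) ∧
        grAct (A₀ m) (traceElt (σ m ℓ) ℓ) (y m) = W.frobeniusTrace ℓ • y' ∧
        ∀ [Fact ℓ.Prime] (hΔ : ¬ (ℓ : ℤ) ∣ minimalDiscriminantInt W)
          (φ₀ : absoluteGaloisGroup (ZMod ℓ)), (∀ x : AlgebraicClosure (ZMod ℓ), φ₀ • x = x ^ ℓ) →
          ∀ γ : 𝒢 m, geomReduction hΔ ((RatClosure.pointsEquiv (K := K) W).symm (j m (γ • y m))) =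
            φ₀ • geomReduction hΔ ((RatClosure.pointsEquiv (K := K) W).symm (j m (γ • y'))))
    (e : ∀ m, ringClassField K ι m →ₐ[K] AlgebraicClosure K)
    (ρ : ∀ m, 𝒢 m →* (ringClassField K ι m ≃ₐ[ℚ] ringClassField K ι m))
    (hρ : ∀ m, Function.Injective (ρ m))
    (hπρ : ∀ m (τ : absoluteGaloisGroup K) (x : ringClassField K ι m),
      τ • e m x = e m (ρ m (π m τ) x))
    (hσρ : ∀ m : ℕ, R m → ∀ ℓ ∈ m.primeFactors,
      (Subgroup.zpowers (σ m ℓ)).map (ρ m) = ringClassGalOver ι m (m / ℓ)) :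
    ∀ m : ℕ, R m → Squarefree m →
      (∀ q ∈ m.primeFactors, IsKolyvaginPrime N W K p q ∧ FrobEqFrobInfty W K (p ^ M) q) →
      ∀ ℓ : ℕ, ℓ.Prime → ℓ ∣ m → ∀ v : HeightOneSpectrum (𝓞 K), (ℓ : 𝓞 K) ∈ v.asIdeal →
        ∀ a : ℕ, (((p : ℤ) ^ a) • kolyvaginClass (W.baseChange K) _ hdiv (hA m)
              (j m (kolyvaginPoint (σ m) (L m) (f m) (y m))) (hPt m) ∈
            selmerLocalKer (W.baseChange K) (v.adicCompletion K) ((p ^ M : ℕ) : ℤ) ↔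
          ((p : ℤ) ^ a) • kolyvaginClass (W.baseChange K) _ hdiv (hA (m / ℓ))
              (j (m / ℓ) (kolyvaginPoint (σ (m / ℓ)) (L (m / ℓ)) (f (m / ℓ)) (y (m / ℓ))))
              (hPt (m / ℓ)) ∈
            (W.baseChange K).torsionLocalKer (v.adicCompletion K) ((p ^ M : ℕ) : ℤ)) :=
  h44_of_prop37_of_ringClassDecomposition_on_of_conductorNorm hK hN hp hp2 hM hW hdiv σ L H f hord y π j
    hj hA hPt hI R h37
    (fun m _ ↦ KolyvaginH44.hsplit_of_ringClassField (N := N) (p := p) (M := M) hK ι σ L H f y j e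
      (KolyvaginH44.hrat_of_galoisDictionary ι σ L H f y π j hj e ρ hρ hπρ) m)
    (KolyvaginH44.hram_of_totallyRamified_on (N := N) (W := W) (p := p) (M := M) hK ι σ π j hj e ρ hρ
      hπρ R hσρ fun m _ ↦ KolyvaginH44.htot_of_classFieldTheory (N := N) (W := W) (p := p) (M := M) hK ι e m)

end Summit.BirchSwinnertonDyer.BirchSwinnertonDyer.Theorems

end
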